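import Summits.HodgeConjecture.HodgeConjecture.Cruxes.BlochSeedDiscOne.RuleDPlate

/-!
line stmt-HodgeConjecture-18881 Cruxes/BlochSeedDiscOne/Lines/birth.lean 814a6a70c14e831a stub_rung_pad4_seedAt

# SigmaH — the cycle-door functional Σ-H as NAMED by hsemireg-c4-1 g29 (bus l.12507, «director to confirm»), typed over idea-crit-hsem-3 g15's
# VERBATIM letter functionals (memo-153 `B136SigmaBudget.lean` PART 2), its shift-invariance (so `RuleDPlate`'s tower applies to `SPlus h sigmaH π`
# with no side condition left), the B136 digits, the π-of-record bookkeeping (officer idea-crit-6 g20 l.12602), and (§5) the one-line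
# reduction `SPlusB h (CopiesLe 116) → SPlus h sigmaH 0` (the diagonal alone prices copies at 28 each)
(plan-lens-HodgeAV-dual g13; claim-free; kit 0; typing only.)

LETTER-MODEL ARITHMETIC ONLY.  `sigmaH D = 28·copies + extPN D 1 + extNP D 3 + extNN D 2 + extPP D 2` is an INTEGER attached to a `DepthBoundA4.Design`;
its identification with `dim Ext²(𝓔_φ, 𝓔_φ)` of a two-term display is the node's letter calculus of record (Mumford's index theorem for non-degenerate
classes on `E × E` + Künneth, Pic⁰-SEPARATED atoms), carried in hsem-3's memo-153 and c4-1's D-MASS ∕ `C4-HGEN-BUDGET` memos and NOT proved here.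
c4-1's CAVEAT travels with the name (l.12507): `sigmaH` is the E₁ (degree-2) TOTAL of the display spectral sequence — a CEILING of ext² always, EQUAL to
it under hsem-3's decidable no-interference condition; a «no seed» reading of `RuleDPlate.SPlus h sigmaH π` therefore needs that condition listed (or a
certificate-fed floor) — the ITEM is not registered here or anywhere (R19.625 (ii): it waits for j341853 and the director's word).
NOTHING here is proved toward HC ∕ HC_CM ∕ HC_AV ∕ №4 ∕ 26512 ∕ 18881 ∕ H2 ∕ any `S⁺`; `Nonex 14 199 8` stays REFUTED as typed; census-neutral.
No `instance`, no notation, no `axiom`, no `native_decide`; closed computations by `decide +kernel` on the tree object `HallB136.B136` only.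

π OF RECORD (officer's cell l.12602, c4-1 l.12507, my NOTE l.12607): `RuleDPlate.BudgetClause σ π D := σ D + 28·(D.rank − 4) + π ≤ 3136` adds `π` ON TOP
of the admissible-frame term `28·(r − 4)`; admissible (Pic⁰-twisted ∕ unipotent) frames pay exactly that term ⇒ **π = 0 is the instance of record**
(the strongest one, `RuleDPlate.sPlus_mono_rider`); the `𝒪^{r−3}`-frame row pays `28·((r − 3)² − 1)` IN PLACE of `28·(r − 4)` (at r = 8: 672 in place
of 112, i.e. π = 560 in that parametrisation, not 672) and is typed rank-uniformly as the budget predicate `FrameBudget σ` below; since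
`28(r − 4) ≤ 28((r − 3)² − 1)` for every integer `r` (`frame_charge_le`), the π = 0 statement implies the 𝒪-frame one (`sPlusB_frame_of_record`).
(`RuleDPlate`'s docstring gloss «π = 672 for a general D₄(𝒪⁵ → 𝓔)» is superseded by this paragraph.)
-/

set_option linter.dupNamespace false
set_option autoImplicit false
set_option maxRecDepth 8192
set_option maxHeartbeats 4000000

namespace Summit.HodgeConjecture.HodgeConjecture.Cruxes.BlochSeedDiscOne.SigmaH

open Summit.HodgeConjecture.HodgeConjecture.Cruxes.BlochSeedDiscOne.DepthBoundA4
open Summit.HodgeConjecture.HodgeConjecture.Cruxes.BlochSeedDiscOne.HeightTower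
open Summit.HodgeConjecture.HodgeConjecture.Cruxes.BlochSeedDiscOne.LeggedFloor
open Summit.HodgeConjecture.HodgeConjecture.Cruxes.BlochSeedDiscOne.HallB136
open Summit.HodgeConjecture.HodgeConjecture.Cruxes.BlochSeedDiscOne.RuleDPlate

/-! ## §1 hsem-3's letter functionals (memo-153 `B136SigmaBudget.lean` PART 2 ll. 664–699, VERBATIM; attribution idea-crit-hsem-3 g15) -/

/-- `n(ν − p) = Δa² − |Δβ|²` of the difference class `ν − p` on one factor (`M² = 2n`, `χ = n`). -/
def dn (p ν : Letter) : ℤ := (ν.a - p.a) ^ 2 - ((ν.x - p.x) ^ 2 + (ν.y - p.y) ^ 2)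

/-- Mumford index of the difference class `ν − p` on one factor `E × E` (letter calculus of record):
`0` = ample (`n > 0`, `Δa > 0`; `H⁰` only), `2` = anti-ample (`n > 0`, `Δa < 0`; `H²` only), `1` = non-degenerate indefinite (`n < 0`; `H¹` only);
`3` FLAGS a degenerate class (`n = 0`: the zero class or a null class), whose cohomology depends on the Pic⁰ decoration. -/
def idx (p ν : Letter) : ℕ :=
  if 0 < dn p ν then (if p.a < ν.a then 0 else 2) else if dn p ν < 0 then 1 else 3

/-- `dim H^{idx}(E × E, ν − p) = |χ(ν − p)| = |n|` for a non-degenerate class. -/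
def hdim (p ν : Letter) : ℕ := (dn p ν).natAbs

/-- Künneth: for four non-degenerate factors `H^•(X, ⊠_f 𝒪(ν_f − p_f))` sits in the single degree `Σ_f idx_f` … -/
def pairDeg (p ν : Cell) : ℕ := idx (p 0) (ν 0) + idx (p 1) (ν 1) + idx (p 2) (ν 2) + idx (p 3) (ν 3)

/-- … with dimension `∏_f |n_f|` (a pair with a degenerate factor — in particular a pair of EQUAL cells — has `pairDim = 0`). -/
def pairDim (p ν : Cell) : ℕ := hdim (p 0) (ν 0) * hdim (p 1) (ν 1) * hdim (p 2) (ν 2) * hdim (p 3) (ν 3)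

/-- `dim Ext^d(𝓟, 𝓝) = h^d(𝓟^∨ ⊗ 𝓝) = Σ_{(p,m_p) ∈ P, (ν,m_ν) ∈ N, pairDeg p ν = d} m_p·m_ν·pairDim p ν` (letter model, separated atoms). -/
def extPN (E : Design) (d : ℕ) : ℕ :=
  (E.P.map fun pm => (E.N.map fun nm => if pairDeg pm.1 nm.1 = d then pm.2 * nm.2 * pairDim pm.1 nm.1 else 0).sum).sum

/-- `dim Ext^d(𝓝, 𝓟) = h^d(𝓝^∨ ⊗ 𝓟)` (difference classes `p − ν`). -/
def extNP (E : Design) (d : ℕ) : ℕ :=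
  (E.N.map fun nm => (E.P.map fun pm => if pairDeg nm.1 pm.1 = d then nm.2 * pm.2 * pairDim nm.1 pm.1 else 0).sum).sum

/-! ### the same-side sums named by c4-1 g29 (l.12507: «extNN ∕ extPP = same sums over distinct same-side cell pairs in degree 2»; typed over ORDERED
entry pairs — both `Hom(Nᵢ,Nⱼ)` and `Hom(Nⱼ,Nᵢ)` counted, each in its own degree; «distinct» is automatic: equal cells have `pairDim = 0`) -/

/-- `Σ_{(x,m) ∈ L} Σ_{(y,n) ∈ L, pairDeg x y = d} m·n·pairDim x y` over ordered entry pairs of ONE side. -/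
def extLL (L : List (Cell × ℕ)) (d : ℕ) : ℕ :=
  (L.map fun a => (L.map fun b => if pairDeg a.1 b.1 = d then a.2 * b.2 * pairDim a.1 b.1 else 0).sum).sum

/-- `dim ⊕_{i ≠ j} Ext^d(N_i, N_j)` (off-diagonal same-side, N). -/
def extNN (E : Design) (d : ℕ) : ℕ := extLL E.N d

/-- `dim ⊕_{i ≠ j} Ext^d(P_i, P_j)` (off-diagonal same-side, P). -/
def extPP (E : Design) (d : ℕ) : ℕ := extLL E.P d

/-- **Σ-H as named by c4-1 g29** (director to confirm): the E₁ degree-2 total of `Ext•(𝓔_φ, 𝓔_φ)` for the two-term display — diagonal `28·copies`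
(`h²(𝒪_X) = C(8,2) = 28` per separated atom) + off-diagonal same-side `extNN D 2 + extPP D 2` + cross terms `extPN D 1 + extNP D 3`. -/
def sigmaH (D : Design) : ℤ :=
  28 * (D.copies : ℤ) + (extPN D 1 : ℤ) + (extNP D 3 : ℤ) + (extNN D 2 : ℤ) + (extPP D 2 : ℤ)

/-! ## §2 Shift-invariance (the functionals see differences of letters and the order of the `a`'s only) -/

theorem dn_shiftL (t : ℤ) (p ν : Letter) : dn (shiftL t p) (shiftL t ν) = dn p ν := by
  simp only [dn, shiftL_a, shiftL_x, shiftL_y, add_sub_add_right_eq_sub]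

theorem idx_shiftL (t : ℤ) (p ν : Letter) : idx (shiftL t p) (shiftL t ν) = idx p ν := by
  simp only [idx, dn_shiftL, shiftL_a, add_lt_add_iff_right]

theorem hdim_shiftL (t : ℤ) (p ν : Letter) : hdim (shiftL t p) (shiftL t ν) = hdim p ν := by
  simp only [hdim, dn_shiftL]

theorem pairDeg_shiftCell (t : ℤ) (x y : Cell) : pairDeg (shiftCell t x) (shiftCell t y) = pairDeg x y := by
  simp only [pairDeg, shiftCell, idx_shiftL]

theorem pairDim_shiftCell (t : ℤ) (x y : Cell) : pairDim (shiftCell t x) (shiftCell t y) = pairDim x y := by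
  simp only [pairDim, shiftCell, hdim_shiftL]

/-- the degree-`d` kernel `[pairDeg = d]·pairDim`. -/
def degKer (d : ℕ) (x y : Cell) : ℕ := if pairDeg x y = d then pairDim x y else 0

theorem degKer_shiftCell (d : ℕ) (t : ℤ) (x y : Cell) : degKer d (shiftCell t x) (shiftCell t y) = degKer d x y := by
  simp only [degKer, pairDeg_shiftCell, pairDim_shiftCell]

/-- the generic weighted double sum `Σ_{(x,m) ∈ A} Σ_{(y,n) ∈ B} m·n·κ x y` (`RuleDPlate.pairSum κ E = dsum κ E.P E.N`). -/
def dsum (κ : Cell → Cell → ℕ) (A B : List (Cell × ℕ)) : ℕ := (A.map fun a => (B.map fun b => a.2 * b.2 * κ a.1 b.1).sum).sum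

theorem dsum_map (κ : Cell → Cell → ℕ) (φ : Cell → Cell) (hκ : ∀ x y, κ (φ x) (φ y) = κ x y) (A B : List (Cell × ℕ)) :
    dsum κ (A.map (entryMap φ)) (B.map (entryMap φ)) = dsum κ A B := by
  simp only [dsum, List.map_map, Function.comp_def, entryMap, hκ]

theorem pairSum_eq_dsum (κ : Cell → Cell → ℕ) (E : Design) : pairSum κ E = dsum κ E.P E.N := rfl

theorem extPN_eq_dsum (E : Design) (d : ℕ) : extPN E d = dsum (degKer d) E.P E.N := by
  simp only [extPN, dsum, degKer, mul_ite, mul_zero]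

theorem extNP_eq_dsum (E : Design) (d : ℕ) : extNP E d = dsum (degKer d) E.N E.P := by
  simp only [extNP, dsum, degKer, mul_ite, mul_zero]

theorem extLL_eq_dsum (L : List (Cell × ℕ)) (d : ℕ) : extLL L d = dsum (degKer d) L L := by
  simp only [extLL, dsum, degKer, mul_ite, mul_zero]

theorem extPN_shiftD (t : ℤ) (E : Design) (d : ℕ) : extPN (shiftD t E) d = extPN E d := by
  rw [extPN_eq_dsum, extPN_eq_dsum]
  show dsum (degKer d) ((mapD (shiftCell t) E).P) ((mapD (shiftCell t) E).N) = _
  rw [mapD_P, mapD_N]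
  exact dsum_map _ _ (degKer_shiftCell d t) _ _

theorem extNP_shiftD (t : ℤ) (E : Design) (d : ℕ) : extNP (shiftD t E) d = extNP E d := by
  rw [extNP_eq_dsum, extNP_eq_dsum]
  show dsum (degKer d) ((mapD (shiftCell t) E).N) ((mapD (shiftCell t) E).P) = _
  rw [mapD_P, mapD_N]
  exact dsum_map _ _ (degKer_shiftCell d t) _ _

theorem extNN_shiftD (t : ℤ) (E : Design) (d : ℕ) : extNN (shiftD t E) d = extNN E d := by
  unfold extNN
  rw [extLL_eq_dsum, extLL_eq_dsum]
  show dsum (degKer d) ((mapD (shiftCell t) E).N) ((mapD (shiftCell t) E).N) = _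
  rw [mapD_N]
  exact dsum_map _ _ (degKer_shiftCell d t) _ _

theorem extPP_shiftD (t : ℤ) (E : Design) (d : ℕ) : extPP (shiftD t E) d = extPP E d := by
  unfold extPP
  rw [extLL_eq_dsum, extLL_eq_dsum]
  show dsum (degKer d) ((mapD (shiftCell t) E).P) ((mapD (shiftCell t) E).P) = _
  rw [mapD_P]
  exact dsum_map _ _ (degKer_shiftCell d t) _ _

/-- **Σ-H is shift-invariant** — the one side condition `RuleDPlate`'s tower asks of `σ`. -/
theorem sigmaH_shiftD (t : ℤ) (D : Design) : sigmaH (shiftD t D) = sigmaH D := by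
  unfold sigmaH
  rw [copies_shift, extPN_shiftD, extNP_shiftD, extNN_shiftD, extPP_shiftD]

/-! ## §3 The tower for `SPlus h sigmaH π` with no side condition left, and the π-of-record bookkeeping -/

/-- ONE STOREY for the statement of record with σ = Σ-H. -/
theorem sPlus_sigmaH_succ_iff (h : ℤ) (π : ℤ) :
    SPlus (h + 1) sigmaH π ↔ SPlus h sigmaH π ∧ FloorFreeB (h + 1) (BudgetClause sigmaH π) :=
  sPlus_succ_iff h sigmaH π sigmaH_shiftD

/-- THE TOWER over `n` storeys with σ = Σ-H. -/
theorem sPlus_sigmaH_add_iff (h : ℤ) (π : ℤ) (n : ℕ) :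
    SPlus (h + n) sigmaH π ↔ SPlus h sigmaH π ∧ ∀ j : ℕ, j < n → FloorFreeB (h + j + 1) (BudgetClause sigmaH π) :=
  sPlus_add_iff h sigmaH π sigmaH_shiftD n

/-- DOWN-INHERITANCE with σ = Σ-H. -/
theorem sPlus_sigmaH_of_up {h : ℤ} (t : ℤ) (ht : 0 ≤ t) (π : ℤ) (H : SPlus (h + t) sigmaH π) : SPlus h sigmaH π :=
  sPlus_of_sPlus_up t ht sigmaH π sigmaH_shiftD H

/-- the `𝒪^{r−3}`-FRAME budget row (semihom-1's PGL-piece law as read by c4-1 g29 l.12507): `σ D + 28·((r − 3)² − 1) ≤ 3 136`, the frame charge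
`28((r−3)² − 1)` REPLACING the admissible-frame term `28(r − 4)` (at r = 8: 672 in place of 112). -/
def FrameBudget (σ : Design → ℤ) (D : Design) : Prop := σ D + 28 * ((D.rank - 3) ^ 2 - 1) ≤ 3136

theorem frameBudget_shiftD (σ : Design → ℤ) (hσ : ∀ (t : ℤ) (D : Design), σ (shiftD t D) = σ D) (t : ℤ) (D : Design) :
    FrameBudget σ (shiftD t D) ↔ FrameBudget σ D := by
  unfold FrameBudget
  rw [hσ, rank_shift]

/-- for every INTEGER rank the `𝒪`-frame charge dominates the admissible one: `28(r − 4) ≤ 28((r − 3)² − 1)` (the difference is `28(r−3)(r−4) ≥ 0`). -/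
theorem frame_charge_le (r : ℤ) : 28 * (r - 4) ≤ 28 * ((r - 3) ^ 2 - 1) := by
  by_cases h : 4 ≤ r
  · nlinarith [h, sq_nonneg (r - 4)]
  · have h' : r ≤ 3 := by omega
    nlinarith [h', sq_nonneg (3 - r)]

/-- at `r = 8` the frame charge is `672 = 112 + 560`. -/
theorem frame_charge_eight : 28 * (((8 : ℤ) - 3) ^ 2 - 1) = 672 ∧ 28 * ((8 : ℤ) - 4) = 112 ∧ (672 : ℤ) = 112 + 560 := by norm_num

/-- the 𝒪-frame room is contained in the admissible room: every design meeting `FrameBudget σ` meets `BudgetClause σ 0`. -/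
theorem budgetClause_zero_of_frameBudget (σ : Design → ℤ) (D : Design) (h : FrameBudget σ D) : BudgetClause σ 0 D := by
  unfold FrameBudget at h
  unfold BudgetClause
  have := frame_charge_le D.rank
  omega

/-- hence **the π = 0 statement of record implies the 𝒪-frame statement** (any σ, any height). -/
theorem sPlusB_frame_of_record {h : ℤ} (σ : Design → ℤ) (H : SPlus h σ 0) : SPlusB h (FrameBudget σ) :=
  sPlusB_mono (fun D hb => budgetClause_zero_of_frameBudget σ D hb) H

/-- ONE STOREY for the 𝒪-frame statement with σ = Σ-H. -/
theorem sPlusB_frame_sigmaH_succ_iff (h : ℤ) :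
    SPlusB (h + 1) (FrameBudget sigmaH) ↔ SPlusB h (FrameBudget sigmaH) ∧ FloorFreeB (h + 1) (FrameBudget sigmaH) :=
  sPlusB_succ_iff h (frameBudget_shiftD sigmaH sigmaH_shiftD)

/-! ## §4 Digits on the tree object `HallB136.B136` (= hsem-3's `extPN D 1 = 12 288`, `extNP D (≤ 3) = 0` on the inlined `RotatedPairB136.D`;
c4-1 l.12507 «B136 ↦ 3 808 + 12 288 = 16 096») and their height-14 twins by shift-invariance (no second computation) -/

theorem extPN_B136_one : extPN B136 1 = 12288 := by decide +kernel

theorem extNP_B136_three : extNP B136 3 = 0 := by decide +kernel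

theorem extNN_B136_two : extNN B136 2 = 0 := by decide +kernel

theorem extPP_B136_two : extPP B136 2 = 0 := by decide +kernel

/-- **Σ-H(B136) = 28·136 + 12 288 + 0 + 0 + 0 = 16 096.** -/
theorem sigmaH_B136 : sigmaH B136 = 16096 := by
  unfold sigmaH
  rw [B136_copies.1, extPN_B136_one, extNP_B136_three, extNN_B136_two, extPP_B136_two]
  norm_num

/-- the same digit at h = 14 (`B136h14 = shiftD 5 B136`), by `sigmaH_shiftD`. -/
theorem sigmaH_B136h14 : sigmaH B136h14 = 16096 := by
  show sigmaH (shiftD 5 B136) = 16096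
  rw [sigmaH_shiftD, sigmaH_B136]

/-- B136 is far OUTSIDE the cycle-door budget of record: `16 096 + 28·(8 − 4) = 16 208 > 3 136` — so B136 is no witness against `SPlus h sigmaH 0`
(it already fails door 1, `HallB136.not_hallUp`, and every PortHall row, `RuleDPlate.not_hallPlusUp_B136`). -/
theorem not_budgetClause_B136 (π : ℤ) (hπ : 0 ≤ π) : ¬ BudgetClause sigmaH π B136 := by
  unfold BudgetClause
  rw [sigmaH_B136, B136_copies.2.1]
  omega

theorem not_frameBudget_B136 : ¬ FrameBudget sigmaH B136 := by
  unfold FrameBudget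
  rw [sigmaH_B136, B136_copies.2.1]
  norm_num

/-- the 4-ample diagonal alone already exceeds the admissible-frame row's normalised form `copies + r ≤ 116` (`C4FrameCharge.covered_budget_iff`'s
normalisation): `136 + 8 = 144 > 116`. -/
theorem diag_B136 : (B136.copies : ℤ) + B136.rank = 144 := by
  rw [B136_copies.1, B136_copies.2.1]
  norm_num

/-! ## §5 The diagonal alone: `SPlus h sigmaH 0` already FOLLOWS from the copies-only statement `SPlusB h (CopiesLe 116)`
(c4-1 l.12507: «the honest unconditional closed form is the four-ample diagonal 28·copies … = dual's CopiesLe-type budget, copies + r ≤ 116»).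
Inside the room `HallUp` gives `r ≥ 0` (and `PortHall₈` with a non-empty P side gives `r ≥ 8`), and `sigmaH ≥ 28·copies`; so the budget of record
forces `copies + r ≤ 116`, hence `copies ≤ 116` (resp. `≤ 108`).  Consequently ANY family-free bound «every h-room design has more than 116 copies»
(`SPlusB h (CopiesLe B)` for some `B ≥ 116`) yields the σ = Σ-H, π = 0 statement — a bound at B = 199 is more than enough; the converse fails badly
(Σ-H prices the cross terms too: B136 has 136 copies but Σ-H = 16 096). -/

theorem diag_le_sigmaH (D : Design) : 28 * (D.copies : ℤ) ≤ sigmaH D := by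
  unfold sigmaH
  omega

theorem rank_nonneg_of_hallUp (D : Design) (hH : HallUp D) : 0 ≤ D.rank := by
  have h := sumP_le_sumN_of_hallUp D hH
  unfold Design.rank
  omega

theorem copies_add_rank_le_of_budget (D : Design) (hb : BudgetClause sigmaH 0 D) : (D.copies : ℤ) + D.rank ≤ 116 := by
  unfold BudgetClause at hb
  have h := diag_le_sigmaH D
  omega

theorem copies_le_of_budget (D : Design) (hH : HallUp D) (hb : BudgetClause sigmaH 0 D) : D.copies ≤ 116 := by
  have h₁ := copies_add_rank_le_of_budget D hb
  have h₂ := rank_nonneg_of_hallUp D hH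
  omega

theorem copies_le_108_of_budget (D : Design) (hp : HallPlusUp D 8) (hpos : 0 < (D.P.map Prod.snd).sum)
    (hb : BudgetClause sigmaH 0 D) : D.copies ≤ 108 := by
  have h₁ := copies_add_rank_le_of_budget D hb
  have h₂ := eight_le_rank_of_hallPlusUp D hp hpos
  omega

/-- **the copies-only statement at B = 116 implies the statement of record** (σ = Σ-H, π = 0; any height). -/
theorem sPlus_sigmaH_of_copiesLe {h : ℤ} (H : SPlusB h (CopiesLe 116)) : SPlus h sigmaH 0 := by
  unfold SPlus SPlusB
  intro D hA hDisj hA1 hRD hH hH8 hμ hB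
  exact H D hA hDisj hA1 hRD hH hH8 hμ (copies_le_of_budget D hH hB)

/-- … hence so does every `SPlusB h (CopiesLe B)` with `116 ≤ B` (e.g. B = 199). -/
theorem sPlus_sigmaH_of_copiesLe_ge {h : ℤ} {B : ℕ} (hB : 116 ≤ B) (H : SPlusB h (CopiesLe B)) : SPlus h sigmaH 0 :=
  sPlus_sigmaH_of_copiesLe (sPlusB_copiesLe_mono hB H)

/-- the same for the 𝒪-frame row (via `sPlusB_frame_of_record`). -/
theorem sPlusB_frame_sigmaH_of_copiesLe {h : ℤ} (H : SPlusB h (CopiesLe 116)) : SPlusB h (FrameBudget sigmaH) :=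
  sPlusB_frame_of_record sigmaH (sPlus_sigmaH_of_copiesLe H)

end Summit.HodgeConjecture.HodgeConjecture.Cruxes.BlochSeedDiscOne.SigmaH
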